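import Summits.PneNP.PneNP.Theorems.SoloBlindTheoremESharp
import Summits.PneNP.PneNP.Theorems.SoloBlindStreamingSimulation
import Summits.PneNP.PneNP.Theorems.SoloBlindStreamingTimeOnly
import HarnessLib

/-!
# COROLLARY E♯.1 (kernel form): the summit relocated to the class-count line of `SAT`

From THEOREM E♯ (`SoloBlindTheoremESharp.lean`) and THEOREM D (`USTREAM_subset_P`,
`SoloBlindStreamingSimulation.lean`):

**COROLLARY E♯.1** (`SoloBlind.pneNP_iff_SAT_tradeoff`). If the one-pass Myhill–Nerode classes of
the length-`i` prefixes of `SAT` at input length `N` (`i ≤ N`) are met by at most `2^{m N}` words,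
with `m` polynomially bounded, then

  `PneNP ↔ ∀ k, SAT ∉ USTREAM (m N + 2·size N + 2) (N ^ k + k)`.

So the summit is EQUIVALENT to a uniform one-pass time–space trade-off for `SAT` of `O(log N)`
bits above ANY class-count majorant `2^{m N}` — in particular above the Myhill–Nerode profile
itself, where THEOREM B gives the lower bound `log₂ #classes` for ALL devices.  (The same
equivalence holds with `SAT` replaced by any `NP`-complete language; for a language of `P` only the
direction "trade-off ⟹ `P ≠ NP`" is available, `SoloBlind.pneNP_of_streaming_tradeoff`.)

**COROLLARY E♯.3** (`SoloBlind.pneNP_iff_no_classInvariant_streaming`, rigidity). `PneNP` is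
ALSO equivalent to: for no `k` is there a uniform one-pass streaming algorithm for `SAT` with
update / report time `N ^ k + k` (no space bound asked) whose state is a COMPLETE INVARIANT of the
one-pass Myhill–Nerode class of the prefix (same state iff same class; THEOREM E♯, algorithm
form).  So a refutation of polynomial-time one-pass machines for `SAT` may assume, at no cost, that
the machine has exactly `#classes` reachable states at every level and that its state map decides
prefix equivalence: state-COUNT minimality is free under the collapse, only the LENGTH of the
state names (THEOREM B / COROLLARY E♯.1) carries the summit.

**COROLLARY E♯.2** (`SoloBlind.pneNP_of_PH_streaming_tradeoff`, `…_linear`): for ANY `L ∈ PH` a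
uniform one-pass trade-off of `2·size N + 2` bits above a class-count majorant (or above `N`) proves
`P ≠ NP` (contrapositive of `thmESharp_PH`).

References: S. A. Cook, *The complexity of theorem-proving procedures*, STOC 1971, Thm 1;
S. Arora, B. Barak, *Computational Complexity*, CUP 2009, Thm. 2.10, Thm. 2.18; D. M. McKay,
C. D. Murray, R. R. Williams, STOC 2019, §2.
-/

namespace Summit.PneNP.PneNP.Theorems.SoloBlind

open Polynomial
open Literature.Computability.Complexity Literature.Computability.MetaComplexity
open Literature.Computability.MetaComplexity.McKayMurrayWilliams2019

/-- **THEOREM D applied to `SAT`**: under `PneNP`, `SAT` has no uniform one-pass streaming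
algorithm with polynomially bounded space and time. [cite: AroraBarak2009, Thm. 2.10] -/
theorem SAT_not_mem_USTREAM_of_pneNP (h : PneNP) {S T : ℕ → ℕ} {k : ℕ}
    (hS : ∀ N, S N ≤ N ^ k + k) (hT : ∀ N, T N ≤ N ^ k + k) : SAT ∉ USTREAM S T :=
  fun hmem => SoloBlind.pneNP_iff_SAT_not_mem_P.1 h (USTREAM_subset_P hS hT hmem)

/-- A polynomial majorant for `m N + 2·size N + 2` and `N ^ k + k` together. [folklore] -/
theorem exists_pow_majorant {m : ℕ → ℕ} {c : ℕ} (hmc : ∀ N, m N ≤ N ^ c + c) (k : ℕ) :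
    ∃ e : ℕ, (∀ N, m N + 2 * Nat.size N + 2 ≤ N ^ e + e) ∧ ∀ N, N ^ k + k ≤ N ^ e + e := by
  obtain ⟨e, he⟩ := exists_eval_le_pow_add_self (X ^ c + 4 * X + X ^ k + Polynomial.C (c + k + 5))
  have hev : ∀ N, (X ^ c + 4 * X + X ^ k + Polynomial.C (c + k + 5) : Polynomial ℕ).eval N =
      N ^ c + 4 * N + N ^ k + (c + k + 5) := fun N => by
    simp [eval_add, eval_mul, eval_pow, eval_X]
  refine ⟨e, fun N => ?_, fun N => ?_⟩
  · have h1 := hmc N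
    have h2 : Nat.size N ≤ N := Nat.size_le.2 Nat.lt_two_pow_self
    have h3 := he N
    rw [hev] at h3
    omega
  · have h3 := he N
    rw [hev] at h3
    omega

/-- **COROLLARY E♯.1 (the summit on the class-count line of `SAT`).** For any polynomially
bounded class-count majorant `2^{m N}` of the one-pass Myhill–Nerode classes of `SAT`:
`PneNP ↔ ∀ k, SAT ∉ USTREAM (m N + 2·size N + 2) (N ^ k + k)`.
[cite: Cook1971, Thm 1; AroraBarak2009, Thm. 2.18; McKayMurrayWilliams2019, §2] -/
theorem pneNP_iff_SAT_tradeoff {m : ℕ → ℕ} {c : ℕ} (hmc : ∀ N, m N ≤ N ^ c + c)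
    (hm : ∀ N i, i ≤ N → ∃ R : Finset (List Bool), R.card ≤ 2 ^ m N ∧
      ∀ p : List Bool, p.length = i → ∃ r ∈ R, r ∈ NerodeStream.cls SAT N p) :
    PneNP ↔ ∀ k : ℕ, SAT ∉ USTREAM (fun N => m N + 2 * Nat.size N + 2) (fun N => N ^ k + k) := by
  constructor
  · intro h k
    obtain ⟨e, hS, hT⟩ := exists_pow_majorant hmc k
    exact SAT_not_mem_USTREAM_of_pneNP h hS hT
  · intro hno
    by_contra h
    have hNP : Nondeterministic.NP ⊆ Classes.P := not_not.1 (pneNP_iff_not_NP_subset_P.not.1 h)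
    obtain ⟨k, hk⟩ := thmESharp hNP (hNP SAT_mem_NP_holds) hm
    exact hno k hk

/-- **The trivial cover**: all words of length `i ≤ N` meet the classes of the length-`i`
prefixes, and there are `2^i ≤ 2^N` of them. [folklore] -/
theorem exists_cover_self (L : Language Bool) (N i : ℕ) (hi : i ≤ N) :
    ∃ R : Finset (List Bool), R.card ≤ 2 ^ N ∧
      ∀ p : List Bool, p.length = i → ∃ r ∈ R, r ∈ NerodeStream.cls L N p := by
  classical
  refine ⟨(Finset.univ : Finset (Fin i → Bool)).image List.ofFn, ?_, fun p hp => ?_⟩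
  · calc ((Finset.univ : Finset (Fin i → Bool)).image List.ofFn).card
        ≤ (Finset.univ : Finset (Fin i → Bool)).card := Finset.card_image_le
      _ = 2 ^ i := by simp
      _ ≤ 2 ^ N := Nat.pow_le_pow_right (by norm_num) hi
  · subst hp
    exact ⟨p, Finset.mem_image.2 ⟨fun c => p[c], Finset.mem_univ _, List.ofFn_getElem⟩,
      NerodeStream.mem_cls_self⟩

/-- **The trivial majorant**: `m N = N` always qualifies (`exists_cover_self`); hence
unconditionally `PneNP ↔ ∀ k, SAT ∉ USTREAM (N + 2·size N + 2) (N ^ k + k)` — the kernel form of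
THEOREM E at space `N + O(log N)`. [folklore] -/
theorem pneNP_iff_SAT_tradeoff_linear :
    PneNP ↔ ∀ k : ℕ, SAT ∉ USTREAM (fun N => N + 2 * Nat.size N + 2) (fun N => N ^ k + k) :=
  pneNP_iff_SAT_tradeoff (m := fun N => N) (c := 1) (fun N => by simp)
    fun N i hi => exists_cover_self SAT N i hi

/-- **COROLLARY E♯.3 (rigidity: it suffices to refute complete-invariant machines).**
`PneNP` holds iff for no `k` there is a uniform one-pass streaming algorithm deciding `SAT` with
empty initial state, update / report time `N ^ k + k`, and a state that is a COMPLETE INVARIANT of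
the one-pass Myhill–Nerode class: prefixes `p, p'` with `|p|, |p'| ≤ N` reach the same state at
input length `N` iff `p' ∈ cls SAT N p`.  (⇒): uniform time `T` forces space `D · T` (halting rule,
`exists_runsInSpace_mul_of_uniformTime`), and `USTREAM(poly, poly) ⊆ P` (THEOREM D).  (⇐): under
`¬ PneNP` THEOREM E♯ (algorithm form, trivial cover) supplies such a machine.
[cite: Cook1971, Thm 1; AroraBarak2009, Thm. 2.18; McKayMurrayWilliams2019, §2] -/
theorem pneNP_iff_no_classInvariant_streaming :
    PneNP ↔ ∀ k : ℕ, ¬ ∃ A : StreamingAlgorithm, (∀ N, A.init N = []) ∧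
      HasUniformUpdateTime A (fun N => N ^ k + k) ∧ HasUniformReportTime A (fun N => N ^ k + k) ∧
      A.Decides SAT ∧
      ∀ (N : ℕ) (p p' : List Bool), p.length ≤ N → p'.length ≤ N →
        (reach A N p = reach A N p' ↔ p' ∈ NerodeStream.cls SAT N p) := by
  constructor
  · rintro h k ⟨A, h0, hU, hR, hD, -⟩
    obtain ⟨D, hS⟩ := exists_runsInSpace_mul_of_uniformTime hU hR
    have hmem : SAT ∈ USTREAM (fun N => D * (N ^ k + k)) (fun N => N ^ k + k) :=
      ⟨A, h0, hS, hU, hR, hD⟩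
    obtain ⟨e₀, he₀⟩ := exists_eval_le_pow_add_self
      (Polynomial.C D * (X ^ k + Polynomial.C k) : Polynomial ℕ)
    have hmc : ∀ N, D * (N ^ k + k) ≤ N ^ e₀ + e₀ := fun N => by
      have h1 := he₀ N
      have h2 : (Polynomial.C D * (X ^ k + Polynomial.C k) : Polynomial ℕ).eval N =
          D * (N ^ k + k) := by
        simp only [eval_mul, eval_add, eval_pow, eval_C, eval_X]
      rw [h2] at h1
      exact h1
    obtain ⟨e, hS', hT'⟩ := exists_pow_majorant hmc k
    exact SAT_not_mem_USTREAM_of_pneNP h (k := e)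
      (fun N => by have h3 := hS' N; omega) hT' hmem
  · intro hno
    by_contra h
    have hNP : Nondeterministic.NP ⊆ Classes.P := not_not.1 (pneNP_iff_not_NP_subset_P.not.1 h)
    obtain ⟨k, A, h0, -, hU, hR, hD, hinv⟩ := thmESharp_alg hNP (hNP SAT_mem_NP_holds)
      (m := fun N => N) fun N i hi => exists_cover_self SAT N i hi
    exact hno k ⟨A, h0, hU, hR, hD, hinv⟩

/-- **COROLLARY E♯.2 (magnification at the Myhill–Nerode line, for EVERY language of `PH`).**
If some `L ∈ PH` whose one-pass classes of length-`i` prefixes at input length `N` are met by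
`≤ 2^{m N}` words admits, for NO `k`, a uniform one-pass streaming algorithm with state
`≤ m N + 2·size N + 2` bits and update / report time `N ^ k + k`, then `P ≠ NP`.  With the cover
`m N = N` (`exists_cover_self`) the class-count hypothesis is void: a uniform one-pass time–space
trade-off at space `N + 2·size N + 2` for ANY `PH` language proves the summit.
[cite: AroraBarak2009, Thm. 5.4; McKayMurrayWilliams2019, §2] -/
theorem pneNP_of_PH_streaming_tradeoff {L : Language Bool} (hL : L ∈ PH) {m : ℕ → ℕ}
    (hm : ∀ N i, i ≤ N → ∃ R : Finset (List Bool), R.card ≤ 2 ^ m N ∧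
      ∀ p : List Bool, p.length = i → ∃ r ∈ R, r ∈ NerodeStream.cls L N p)
    (hno : ∀ k : ℕ, L ∉ USTREAM (fun N => m N + 2 * Nat.size N + 2) (fun N => N ^ k + k)) :
    PneNP := by
  by_contra h
  obtain ⟨k, hk⟩ := thmESharp_PH h hL hm
  exact hno k hk

/-- **COROLLARY E♯.2, linear form.** A `PH` language outside every
`USTREAM (N + 2·size N + 2) (N ^ k + k)` proves `P ≠ NP`. [cite: McKayMurrayWilliams2019, §2] -/
theorem pneNP_of_PH_streaming_tradeoff_linear {L : Language Bool} (hL : L ∈ PH)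
    (hno : ∀ k : ℕ, L ∉ USTREAM (fun N => N + 2 * Nat.size N + 2) (fun N => N ^ k + k)) :
    PneNP :=
  pneNP_of_PH_streaming_tradeoff hL (m := fun N => N) (fun N i hi => exists_cover_self L N i hi) hno

end Summit.PneNP.PneNP.Theorems.SoloBlind
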